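import Summits.AnomalousDissipation.AnomalousDissipation.Theorems.SawtoothPulseCascadeK1LocalisedCascadeSidebandEnergyParity
import Summits.AnomalousDissipation.AnomalousDissipation.Theorems.SawtoothPulseCascadeK1LocalisedCascadeExactChirpSelf
import Summits.AnomalousDissipation.AnomalousDissipation.Theorems.SawtoothPulseCascadeK1LocalisedCascadeChirpRounding
import Summits.AnomalousDissipation.AnomalousDissipation.Theorems.SawtoothPulseCascadeK1LocalisedCascadeCircleCutoff

/-!
# K1loc, line `Spectral` / thin start — helper: THE MID-BAND ENERGY `E_n` OF THE PHASE-`j` CHIRP (S-D start, «ChirpSidebandEnergy»)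

Helper file of the prover lane on the crux `K1LocalisedCascade` (stmt-AnomalousDissipation-19491), route
`SawtoothPulseCascade` (glue for the fibre-`L²` form of the window lemma,
`…FibreWindowL2.sum_window_sq_norm_comp_shearMap_le_fibreL2`, whose input per fibre `n` is `∫_𝕋‖g^mid_n‖² ≤ E_n` with
`g^mid_n = ψ ⋆ g_n` the circle cut-off (`…CircleCutoff`) of the chirp `g_n = twist(γU_j) n` onto a finite frequency set `S`).
This file turns the one-tooth sideband bound of `…SidebandEnergy` into that `E_n`:
* §1 **Parseval for the cut-off**: `∫_𝕋‖(ψ⋆g)(y)‖²dy = Σ_{m∈S}‖ψ(m)‖²‖ĝ(m)‖² ≤ Σ_{m∈S}‖ĝ(m)‖²` (`‖ψ‖ ≤ 1`, `supp ψ ⊆ S`);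
* §2 **the `N`-tooth exact chirp** `g_N = h ∘ (N•·)`, `h` the one-tooth chirp of strain `λ′` (so `g_N` has strain `λ = Nλ′` and
  `N` teeth): for a finite `S` whose multiples of `N` satisfy `D′ ≤ |q/N ± λ′|` (`D′ ≥ 2`; implied by `N·D′ ≤ |q ± Nλ′|`),
  `Σ_{q∈S}‖ĝ_N(q)‖² ≤ (8/π²)/(D′−1)`, and `(4/π²)/(D′−1)` when `λ′` is even (`…SidebandEnergyParity`);
* §3 **rounding**: if `|n·ψ(t) − λ′·tri(2πNt)/(2π)| ≤ η` on `ℝ` then `√Σ_S‖𝓕(twist ψ n)‖² ≤ √Σ_S‖ĝ_N‖² + 2πη`, hence the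
  assembled bound `∫_𝕋‖ψ_c ⋆ twist ψ n‖² ≤ (√((8/π²)/(D′−1)) + 2πη)²`;
* §4 **the cascade instance**: `ψ = γU_j` (`γ = G ∈ ℕ`), `N = N_j`, `N_jλ′ = nG`, `η = |n|G(2e^{1/2}−1)δ_j/(2πN_j)`
  (`…ChirpRounding.abs_U_sub_exactProfile_le`), the one-tooth chirp supplied by `…ExactChirpSelf.exists_exactChirp`:
  `E_n ≤ (√((8/π²)/(D′−1)) + |n|G(2e^{1/2}−1)δ_j/N_j)²` for every cut-off set `S` with `N_j·D′ ≤ |q ± nG|` on `S`.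
No definitions; nothing about the crux. [cite: Grafakos2014, Prop. 3.1.2 (5) and Prop. 3.2.7 (3)] [problem: turb]
-/

-- `Summit.<Summit>.<Problem>`: single-conjunct summit, the duplicate namespace segment is deliberate.
set_option linter.dupNamespace false

noncomputable section

namespace Summit.AnomalousDissipation.AnomalousDissipation.Theorems.SawtoothPulseCascade.K1Start

open MeasureTheory Set Filter Topology UnitAddTorus Function Complex AddCircle
open scoped Real
open Literature.Analysis Literature.Analysis.FunctionSpaces Literature.Analysis.FunctionSpaces.Torus Literature.Analysis.FluidPDE
open Literature.Analysis.FluidPDE.ShearStage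
open Literature.Analysis.FluidPDE.SawtoothCascade Literature.Analysis.FluidPDE.SawtoothCascade.CascadeParams
open Summit.AnomalousDissipation.AnomalousDissipation.Theorems.SawtoothPulseCascade.K1Window

/-! ## §1 Energy of a circle cut-off (Parseval) -/

/-- **Parseval for the cut-off**: for continuous `g` and a multiplier `ψ` supported in the finite set `S`,
`∫_𝕋 ‖(ψ⋆g)(y)‖² dy = Σ_{m∈S} ‖ψ(m)‖²·‖ĝ(m)‖²` (the cut-off has coefficients `ψ(m)ĝ(m)`, `…CircleCutoff.fourierCoeff_circleCutoff`).
[cite: Grafakos2014, Prop. 3.2.7 (3)] -/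
theorem integral_norm_sq_circleCutoff_eq {g : UnitAddCircle → ℂ} (hg : Continuous g) {ψ : ℤ → ℂ} {S : Finset ℤ}
    (hψ : ∀ m, m ∉ S → ψ m = 0) :
    ∫ y : UnitAddCircle, ‖∫ s : UnitAddCircle, (∑ l ∈ S, ψ l * fourier (-l) s) * g (y + s)‖ ^ 2 =
      ∑ m ∈ S, ‖ψ m‖ ^ 2 * ‖fourierCoeff g m‖ ^ 2 := by
  classical
  have hkc : Continuous fun s : UnitAddCircle => ∑ l ∈ S, ψ l * fourier (-l) s :=
    continuous_finsetSum _ fun l _ => continuous_const.mul (fourier (-l)).continuous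
  have hFc : Continuous fun y : UnitAddCircle => ∫ s : UnitAddCircle, (∑ l ∈ S, ψ l * fourier (-l) s) * g (y + s) :=
    continuous_circleCutoff hkc hg
  set F : UnitAddCircle → ℂ := fun y => ∫ s : UnitAddCircle, (∑ l ∈ S, ψ l * fourier (-l) s) * g (y + s) with hF
  show ∫ y : UnitAddCircle, ‖F y‖ ^ 2 = _
  -- `F` is bounded, hence in `L²`; Parseval
  obtain ⟨B, hB⟩ := isCompact_univ.exists_bound_of_continuousOn (hFc.continuousOn (s := univ))
  have hmem : MemLp F 2 haarAddCircle :=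
    (memLp_top_of_bound hFc.aestronglyMeasurable B (Eventually.of_forall fun x => hB x (mem_univ x))).mono_exponent
      le_top
  have hP := hasSum_sq_fourierCoeff (hmem.toLp _)
  have hcoe : ∀ p, fourierCoeff (hmem.toLp _) p = fourierCoeff F p := fun p => by
    simp only [fourierCoeff]
    exact integral_congr_ae (by filter_upwards [MemLp.coeFn_toLp hmem] with x hx; simp only [hx])
  simp_rw [hcoe] at hP
  have h1 : ∫ t, ‖(hmem.toLp _) t‖ ^ 2 ∂haarAddCircle = ∫ t, ‖F t‖ ^ 2 ∂haarAddCircle :=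
    integral_congr_ae (by filter_upwards [MemLp.coeFn_toLp hmem] with t ht; rw [ht])
  rw [h1] at hP
  -- the coefficients of the cut-off
  have hcoefF : ∀ m, fourierCoeff F m = ψ m * fourierCoeff g m := fun m => fourierCoeff_circleCutoff hg hψ m
  simp_rw [hcoefF] at hP
  have hfin : HasSum (fun m : ℤ => ‖ψ m * fourierCoeff g m‖ ^ 2) (∑ m ∈ S, ‖ψ m * fourierCoeff g m‖ ^ 2) :=
    hasSum_sum_of_ne_finset_zero fun m hm => by rw [hψ m hm, zero_mul, norm_zero, zero_pow two_ne_zero]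
  rw [← volume_unitAddCircle_eq_haar] at hP
  rw [hP.unique hfin]
  exact Finset.sum_congr rfl fun m _ => by rw [norm_mul, mul_pow]

/-- **Energy of a cut-off with a bounded multiplier**: if moreover `‖ψ(m)‖ ≤ 1` on `S`, then
`∫_𝕋 ‖(ψ⋆g)(y)‖² dy ≤ Σ_{m∈S} ‖ĝ(m)‖²` — the `E_n` socket of `…FibreWindowL2` reduced to a coefficient sum.
[cite: Grafakos2014, Prop. 3.2.7 (3)] -/
theorem integral_norm_sq_circleCutoff_le {g : UnitAddCircle → ℂ} (hg : Continuous g) {ψ : ℤ → ℂ} {S : Finset ℤ}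
    (hψ : ∀ m, m ∉ S → ψ m = 0) (hψ1 : ∀ m ∈ S, ‖ψ m‖ ≤ 1) :
    ∫ y : UnitAddCircle, ‖∫ s : UnitAddCircle, (∑ l ∈ S, ψ l * fourier (-l) s) * g (y + s)‖ ^ 2 ≤
      ∑ m ∈ S, ‖fourierCoeff g m‖ ^ 2 := by
  rw [integral_norm_sq_circleCutoff_eq hg hψ]
  refine Finset.sum_le_sum fun m hm => ?_
  have h1 : ‖ψ m‖ ^ 2 ≤ 1 := pow_le_one₀ (norm_nonneg _) (hψ1 m hm)
  calc ‖ψ m‖ ^ 2 * ‖fourierCoeff g m‖ ^ 2 ≤ 1 * ‖fourierCoeff g m‖ ^ 2 := by gcongr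
    _ = ‖fourierCoeff g m‖ ^ 2 := one_mul _

/-! ## §2 Sideband energy of the `N`-tooth exact chirp -/

/-- Divisibility bookkeeping for the notch: if `N ∣ q` and `N·D′ ≤ |q ± N·λ′|`, then `D′ ≤ |q/N ± λ′|`. [folklore] -/
theorem sideband_div_of_mul {N : ℕ} (hN : 0 < N) {D' : ℕ} {lam' q : ℤ} (hdq : (N : ℤ) ∣ q)
    (h : (N : ℤ) * D' ≤ |q + N * lam'| ∧ (N : ℤ) * D' ≤ |q - N * lam'|) :
    (D' : ℤ) ≤ |q / N + lam'| ∧ (D' : ℤ) ≤ |q / N - lam'| := by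
  obtain ⟨q', rfl⟩ := hdq
  have hNpos : (0 : ℤ) < N := by exact_mod_cast hN
  rw [Int.mul_ediv_cancel_left q' hNpos.ne']
  rw [show (N : ℤ) * q' + N * lam' = N * (q' + lam') by ring, show (N : ℤ) * q' - N * lam' = N * (q' - lam') by ring,
    abs_mul, abs_mul, abs_of_pos hNpos] at h
  exact ⟨le_of_mul_le_mul_left h.1 hNpos, le_of_mul_le_mul_left h.2 hNpos⟩

/-- **Sideband energy of the `N`-tooth exact chirp** `g_N = h ∘ (N•·)`, `h(t) = exp(−2πiλ′·tri(2πt)/(2π))` the one-tooth chirp of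
strain `λ′ ∈ ℤ` (`N ≥ 1`): for every finite `S` whose multiples `q` of `N` satisfy `D′ ≤ |q/N + λ′|` and `D′ ≤ |q/N − λ′|`
(`D′ ≥ 2`), `Σ_{q∈S} ‖ĝ_N(q)‖² ≤ (8/π²)·1/(D′−1)` — the non-multiples carry no energy (`…SidebandEnergy` §1) and the multiples are
the one-tooth sideband (`…SidebandEnergy` §2). [cite: Grafakos2014, Prop. 3.1.2 (5)] -/
theorem sum_sq_norm_fourierCoeff_nTooth_sideband_le {N : ℕ} (hN : 0 < N) {lam' : ℤ} {h : UnitAddCircle → ℂ}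
    (hh : ∀ t : ℝ, h (t : UnitAddCircle) = Complex.exp (-(2 * π * I * lam' * ((tri (2 * π * t) / (2 * π) : ℝ) : ℂ))))
    (hhc : Continuous h) {D' : ℕ} (hD' : 2 ≤ D') (S : Finset ℤ)
    (hS : ∀ q ∈ S, (N : ℤ) ∣ q → (D' : ℤ) ≤ |q / N + lam'| ∧ (D' : ℤ) ≤ |q / N - lam'|) :
    ∑ q ∈ S, ‖fourierCoeff (fun t : UnitAddCircle => h (N • t)) q‖ ^ 2 ≤ 8 / π ^ 2 * (1 / ((D' : ℝ) - 1)) := by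
  classical
  set T : Finset ℤ := (S.filter fun q : ℤ => (N : ℤ) ∣ q).image fun q => q / N with hT
  have hST : ∀ q ∈ S, (N : ℤ) ∣ q → q / N ∈ T := fun q hq hdq =>
    Finset.mem_image.2 ⟨q, Finset.mem_filter.2 ⟨hq, hdq⟩, rfl⟩
  have hT' : ∀ q' ∈ T, (D' : ℤ) ≤ |q' + lam'| ∧ (D' : ℤ) ≤ |q' - lam'| := by
    intro q' hq'
    obtain ⟨q, hq, rfl⟩ := Finset.mem_image.1 hq'
    exact hS q (Finset.mem_filter.1 hq).1 (Finset.mem_filter.1 hq).2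
  exact (sum_sq_norm_fourierCoeff_comp_nsmul_le hN hhc S T hST).trans
    (sum_sq_norm_fourierCoeff_exactChirp_sideband_le hh hhc hD' T hT')

/-- **Sideband energy of the `N`-tooth exact chirp, even strain `λ′`**: under the hypotheses of
`sum_sq_norm_fourierCoeff_nTooth_sideband_le` and `λ′` even, `Σ_{q∈S} ‖ĝ_N(q)‖² ≤ (4/π²)·1/(D′−1)` (parity halving,
`…SidebandEnergyParity`). [cite: Grafakos2014, Prop. 3.1.2 (5)] -/
theorem sum_sq_norm_fourierCoeff_nTooth_sideband_le_of_even {N : ℕ} (hN : 0 < N) {lam' : ℤ} (hlam' : Even lam')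
    {h : UnitAddCircle → ℂ}
    (hh : ∀ t : ℝ, h (t : UnitAddCircle) = Complex.exp (-(2 * π * I * lam' * ((tri (2 * π * t) / (2 * π) : ℝ) : ℂ))))
    (hhc : Continuous h) {D' : ℕ} (hD' : 2 ≤ D') (S : Finset ℤ)
    (hS : ∀ q ∈ S, (N : ℤ) ∣ q → (D' : ℤ) ≤ |q / N + lam'| ∧ (D' : ℤ) ≤ |q / N - lam'|) :
    ∑ q ∈ S, ‖fourierCoeff (fun t : UnitAddCircle => h (N • t)) q‖ ^ 2 ≤ 4 / π ^ 2 * (1 / ((D' : ℝ) - 1)) := by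
  classical
  set T : Finset ℤ := (S.filter fun q : ℤ => (N : ℤ) ∣ q).image fun q => q / N with hT
  have hST : ∀ q ∈ S, (N : ℤ) ∣ q → q / N ∈ T := fun q hq hdq =>
    Finset.mem_image.2 ⟨q, Finset.mem_filter.2 ⟨hq, hdq⟩, rfl⟩
  have hT' : ∀ q' ∈ T, (D' : ℤ) ≤ |q' + lam'| ∧ (D' : ℤ) ≤ |q' - lam'| := by
    intro q' hq'
    obtain ⟨q, hq, rfl⟩ := Finset.mem_image.1 hq'
    exact hS q (Finset.mem_filter.1 hq).1 (Finset.mem_filter.1 hq).2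
  exact (sum_sq_norm_fourierCoeff_comp_nsmul_le hN hhc S T hST).trans
    (sum_sq_norm_fourierCoeff_exactChirp_sideband_le_of_even hlam' hh hhc hD' T hT')

/-! ## §3 Rounding: the actual chirp `twist ψ n` next to the `N`-tooth exact one -/

/-- The `N`-tooth chirp on real lifts: `g_N(t) = exp(−2πiλ′·tri(2πNt)/(2π))`. [folklore] -/
theorem nTooth_coe (N : ℕ) {lam' : ℤ} {h : UnitAddCircle → ℂ}
    (hh : ∀ t : ℝ, h (t : UnitAddCircle) = Complex.exp (-(2 * π * I * lam' * ((tri (2 * π * t) / (2 * π) : ℝ) : ℂ))))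
    (t : ℝ) :
    h (N • ((t : ℝ) : UnitAddCircle)) =
      Complex.exp (-(2 * π * I * lam' * ((tri (2 * π * (N * t)) / (2 * π) : ℝ) : ℂ))) := by
  rw [nsmul_coe, hh]

/-- **The rounded chirp next to the `N`-tooth exact one**: if `|n·ψ(t) − λ′·tri(2πNt)/(2π)| ≤ η` for all real `t`, then
`‖twist ψ n − g_N‖ ≤ 2πη` pointwise and hence `√(Σ_{q∈S}‖𝓕(twist ψ n)(q)‖²) ≤ √(Σ_{q∈S}‖ĝ_N(q)‖²) + 2πη` for every finite `S`.
[cite: Grafakos2014, Prop. 3.2.7 (3)] -/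
theorem sqrt_sum_sq_norm_fourierCoeff_twist_nTooth_le (ψ : ShearProfile) (n lam' : ℤ) (N : ℕ) {h : UnitAddCircle → ℂ}
    (hh : ∀ t : ℝ, h (t : UnitAddCircle) = Complex.exp (-(2 * π * I * lam' * ((tri (2 * π * t) / (2 * π) : ℝ) : ℂ))))
    (hhc : Continuous h) {η : ℝ} (hη : ∀ t : ℝ, |n * ψ t - lam' * (tri (2 * π * (N * t)) / (2 * π))| ≤ η)
    (S : Finset ℤ) :
    Real.sqrt (∑ q ∈ S, ‖fourierCoeff (twist ψ n) q‖ ^ 2) ≤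
      Real.sqrt (∑ q ∈ S, ‖fourierCoeff (fun t : UnitAddCircle => h (N • t)) q‖ ^ 2) + 2 * π * η := by
  have hgc : Continuous fun t : UnitAddCircle => h (N • t) := hhc.comp (continuous_nsmul N)
  refine sqrt_sum_sq_norm_fourierCoeff_le_of_near (continuous_twist ψ n) hgc (fun x => ?_) S
  obtain ⟨t, rfl⟩ := QuotientAddGroup.mk_surjective x
  have hx : (QuotientAddGroup.mk t : UnitAddCircle) = ((t : ℝ) : UnitAddCircle) := rfl
  rw [hx, twist_coe, nTooth_coe N hh t]
  have h2 := norm_exp_neg_two_pi_I_sub_le (n * ψ t) (lam' * (tri (2 * π * (N * t)) / (2 * π)))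
  have e1 : Complex.exp (-(2 * π * I * ((n * ψ t : ℝ) : ℂ))) = Complex.exp (-(2 * Real.pi * Complex.I * n * ψ t)) := by
    congr 1; push_cast; ring
  have e2 : Complex.exp (-(2 * π * I * ((lam' * (tri (2 * π * (N * t)) / (2 * π)) : ℝ) : ℂ))) =
      Complex.exp (-(2 * π * I * lam' * ((tri (2 * π * (N * t)) / (2 * π) : ℝ) : ℂ))) := by
    congr 1; push_cast; ring
  rw [e1, e2] at h2
  exact h2.trans (by nlinarith [hη t, Real.pi_pos, abs_nonneg (n * ψ t - lam' * (tri (2 * π * (N * t)) / (2 * π)))])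

/-- **`E_n` for a rounded `N`-tooth chirp.**  Let `ψ_c` be a multiplier supported in the finite set `S` with `‖ψ_c‖ ≤ 1`, let
`h` be the one-tooth exact chirp of strain `λ′`, `N ≥ 1`, `D′ ≥ 2`, and assume the notch condition `D′ ≤ |q/N ± λ′|` for the
multiples `q ∈ S` of `N` and the rounding hypothesis `|n·ψ(t) − λ′·tri(2πNt)/(2π)| ≤ η` on `ℝ`.  Then
`∫_𝕋 ‖(ψ_c ⋆ twist ψ n)(y)‖² dy ≤ (√((8/π²)/(D′−1)) + 2πη)²`. [cite: Grafakos2014, Prop. 3.1.2 (5) and Prop. 3.2.7 (3)] -/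
theorem integral_norm_sq_circleCutoff_twist_le (ψ : ShearProfile) (n lam' : ℤ) {N : ℕ} (hN : 0 < N)
    {h : UnitAddCircle → ℂ}
    (hh : ∀ t : ℝ, h (t : UnitAddCircle) = Complex.exp (-(2 * π * I * lam' * ((tri (2 * π * t) / (2 * π) : ℝ) : ℂ))))
    (hhc : Continuous h) {η : ℝ} (hη : ∀ t : ℝ, |n * ψ t - lam' * (tri (2 * π * (N * t)) / (2 * π))| ≤ η)
    {ψc : ℤ → ℂ} {S : Finset ℤ} (hψc : ∀ m, m ∉ S → ψc m = 0) (hψc1 : ∀ m ∈ S, ‖ψc m‖ ≤ 1)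
    {D' : ℕ} (hD' : 2 ≤ D') (hS : ∀ q ∈ S, (N : ℤ) ∣ q → (D' : ℤ) ≤ |q / N + lam'| ∧ (D' : ℤ) ≤ |q / N - lam'|) :
    ∫ y : UnitAddCircle, ‖∫ s : UnitAddCircle, (∑ l ∈ S, ψc l * fourier (-l) s) * twist ψ n (y + s)‖ ^ 2 ≤
      (Real.sqrt (8 / π ^ 2 * (1 / ((D' : ℝ) - 1))) + 2 * π * η) ^ 2 := by
  have h1 := integral_norm_sq_circleCutoff_le (continuous_twist ψ n) hψc hψc1
  have h2 := sqrt_sum_sq_norm_fourierCoeff_twist_nTooth_le ψ n lam' N hh hhc hη S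
  have h3 := sum_sq_norm_fourierCoeff_nTooth_sideband_le hN hh hhc hD' S hS
  have h4 : Real.sqrt (∑ q ∈ S, ‖fourierCoeff (twist ψ n) q‖ ^ 2) ≤
      Real.sqrt (8 / π ^ 2 * (1 / ((D' : ℝ) - 1))) + 2 * π * η :=
    h2.trans (by gcongr)
  calc ∫ y : UnitAddCircle, ‖∫ s : UnitAddCircle, (∑ l ∈ S, ψc l * fourier (-l) s) * twist ψ n (y + s)‖ ^ 2
      ≤ ∑ m ∈ S, ‖fourierCoeff (twist ψ n) m‖ ^ 2 := h1
    _ = (Real.sqrt (∑ q ∈ S, ‖fourierCoeff (twist ψ n) q‖ ^ 2)) ^ 2 :=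
        (Real.sq_sqrt (Finset.sum_nonneg fun q _ => sq_nonneg _)).symm
    _ ≤ (Real.sqrt (8 / π ^ 2 * (1 / ((D' : ℝ) - 1))) + 2 * π * η) ^ 2 :=
        pow_le_pow_left₀ (Real.sqrt_nonneg _) h4 2

/-- **`E_n` for a rounded `N`-tooth chirp, even `λ′`**: as `integral_norm_sq_circleCutoff_twist_le` with the parity-halved
sideband constant, `∫_𝕋 ‖(ψ_c ⋆ twist ψ n)(y)‖² dy ≤ (√((4/π²)/(D′−1)) + 2πη)²`.
[cite: Grafakos2014, Prop. 3.1.2 (5) and Prop. 3.2.7 (3)] -/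
theorem integral_norm_sq_circleCutoff_twist_le_of_even (ψ : ShearProfile) (n lam' : ℤ) (hlam' : Even lam') {N : ℕ}
    (hN : 0 < N) {h : UnitAddCircle → ℂ}
    (hh : ∀ t : ℝ, h (t : UnitAddCircle) = Complex.exp (-(2 * π * I * lam' * ((tri (2 * π * t) / (2 * π) : ℝ) : ℂ))))
    (hhc : Continuous h) {η : ℝ} (hη : ∀ t : ℝ, |n * ψ t - lam' * (tri (2 * π * (N * t)) / (2 * π))| ≤ η)
    {ψc : ℤ → ℂ} {S : Finset ℤ} (hψc : ∀ m, m ∉ S → ψc m = 0) (hψc1 : ∀ m ∈ S, ‖ψc m‖ ≤ 1)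
    {D' : ℕ} (hD' : 2 ≤ D') (hS : ∀ q ∈ S, (N : ℤ) ∣ q → (D' : ℤ) ≤ |q / N + lam'| ∧ (D' : ℤ) ≤ |q / N - lam'|) :
    ∫ y : UnitAddCircle, ‖∫ s : UnitAddCircle, (∑ l ∈ S, ψc l * fourier (-l) s) * twist ψ n (y + s)‖ ^ 2 ≤
      (Real.sqrt (4 / π ^ 2 * (1 / ((D' : ℝ) - 1))) + 2 * π * η) ^ 2 := by
  have h1 := integral_norm_sq_circleCutoff_le (continuous_twist ψ n) hψc hψc1
  have h2 := sqrt_sum_sq_norm_fourierCoeff_twist_nTooth_le ψ n lam' N hh hhc hη S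
  have h3 := sum_sq_norm_fourierCoeff_nTooth_sideband_le_of_even hN hlam' hh hhc hD' S hS
  have h4 : Real.sqrt (∑ q ∈ S, ‖fourierCoeff (twist ψ n) q‖ ^ 2) ≤
      Real.sqrt (4 / π ^ 2 * (1 / ((D' : ℝ) - 1))) + 2 * π * η :=
    h2.trans (by gcongr)
  calc ∫ y : UnitAddCircle, ‖∫ s : UnitAddCircle, (∑ l ∈ S, ψc l * fourier (-l) s) * twist ψ n (y + s)‖ ^ 2
      ≤ ∑ m ∈ S, ‖fourierCoeff (twist ψ n) m‖ ^ 2 := h1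
    _ = (Real.sqrt (∑ q ∈ S, ‖fourierCoeff (twist ψ n) q‖ ^ 2)) ^ 2 :=
        (Real.sq_sqrt (Finset.sum_nonneg fun q _ => sq_nonneg _)).symm
    _ ≤ (Real.sqrt (4 / π ^ 2 * (1 / ((D' : ℝ) - 1))) + 2 * π * η) ^ 2 :=
        pow_le_pow_left₀ (Real.sqrt_nonneg _) h4 2

/-! ## §4 The cascade instance: `ψ = γU_j`, `N = N_j`, `N_jλ′ = nγ` -/

/-- **The phase-`j` profile next to the `N_j`-tooth exact phase**: with `γ = G ∈ ℕ` and `N_j·λ′ = n·G`,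
`|n·γU_j(t) − λ′·tri(2πN_jt)/(2π)| = |n|G·|U_j(t) − tri(2πN_jt)/(2πN_j)| ≤ |n|G·(2e^{1/2}−1)δ_j/(2πN_j)`
(`…ChirpRounding.abs_U_sub_exactProfile_le`; `δ₀ > 0`, `d > 0`, `N_j ≥ 1`). [cite: Folland1999, Prop. 2.53] -/
theorem abs_phase_sub_nTooth_le (P : CascadeParams) (hδ₀ : 0 < P.δ₀) (hd : 0 < P.d) {j : ℕ} (hN : 0 < P.N j)
    {G : ℕ} (hG : P.γ = G) (n lam' : ℤ) (hlam : (P.N j : ℤ) * lam' = n * G) (t : ℝ) :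
    |n * amp ⟨P.U j, P.U_periodic j, P.contDiff_U (P.δ_pos hδ₀ hd j)⟩ P.γ t -
        lam' * (tri (2 * π * (P.N j * t)) / (2 * π))| ≤
      |(n : ℝ)| * G * ((2 * Real.exp (1 / 2) - 1) * P.δ j / (2 * π * P.N j)) := by
  have hNr : (0 : ℝ) < P.N j := by exact_mod_cast hN
  have hπ : 0 < π := Real.pi_pos
  have hlamr : (lam' : ℝ) * P.N j = n * G := by
    have h := congrArg (fun z : ℤ => (z : ℝ)) hlam
    push_cast at h
    linarith
  have hamp : amp ⟨P.U j, P.U_periodic j, P.contDiff_U (P.δ_pos hδ₀ hd j)⟩ P.γ t = P.γ * P.U j t := rfl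
  have key : n * amp ⟨P.U j, P.U_periodic j, P.contDiff_U (P.δ_pos hδ₀ hd j)⟩ P.γ t -
      lam' * (tri (2 * π * (P.N j * t)) / (2 * π)) =
      n * G * (P.U j t - tri (2 * π * P.N j * t) / (2 * π * P.N j)) := by
    rw [hamp, hG, ← mul_assoc (2 * π) (P.N j : ℝ) t]
    have e : (lam' : ℝ) = n * G / P.N j := by rw [eq_div_iff hNr.ne']; exact hlamr
    rw [e]
    field_simp
  rw [key, abs_mul, abs_mul, Nat.abs_cast]
  exact mul_le_mul_of_nonneg_left (abs_U_sub_exactProfile_le P hδ₀ hd hN t) (by positivity)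

/-- **`E_n` of the phase-`j` chirp (turnkey for `…FibreWindowL2`).**  Cascade parameters with `δ₀ > 0`, `d > 0`, `N_j ≥ 1`,
integer intensity `γ = G`, a fibre `n` and `λ′ ∈ ℤ` with `N_j·λ′ = n·G` (the strain of `twist(γU_j) n` is `nG`, spread over `N_j`
teeth); a cut-off multiplier `ψ_c` supported in the finite set `S` with `‖ψ_c‖ ≤ 1`, and the notch condition
`N_j·D′ ≤ |q + nG|`, `N_j·D′ ≤ |q − nG|` for the multiples `q ∈ S` of `N_j` (`D′ ≥ 2`).  Then
`∫_𝕋 ‖(ψ_c ⋆ twist(γU_j) n)(y)‖² dy ≤ (√((8/π²)/(D′−1)) + |n|G(2e^{1/2}−1)δ_j/N_j)²`.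
[cite: Grafakos2014, Prop. 3.1.2 (5) and Prop. 3.2.7 (3)] -/
theorem integral_norm_sq_circleCutoff_twist_cascade_le (P : CascadeParams) (hδ₀ : 0 < P.δ₀) (hd : 0 < P.d) {j : ℕ}
    (hN : 0 < P.N j) {G : ℕ} (hG : P.γ = G) (n lam' : ℤ) (hlam : (P.N j : ℤ) * lam' = n * G)
    {ψc : ℤ → ℂ} {S : Finset ℤ} (hψc : ∀ m, m ∉ S → ψc m = 0) (hψc1 : ∀ m ∈ S, ‖ψc m‖ ≤ 1) {D' : ℕ} (hD' : 2 ≤ D')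
    (hS : ∀ q ∈ S, (P.N j : ℤ) ∣ q → (P.N j : ℤ) * D' ≤ |q + n * G| ∧ (P.N j : ℤ) * D' ≤ |q - n * G|) :
    ∫ y : UnitAddCircle, ‖∫ s : UnitAddCircle, (∑ l ∈ S, ψc l * fourier (-l) s) *
        twist (amp ⟨P.U j, P.U_periodic j, P.contDiff_U (P.δ_pos hδ₀ hd j)⟩ P.γ) n (y + s)‖ ^ 2 ≤
      (Real.sqrt (8 / π ^ 2 * (1 / ((D' : ℝ) - 1))) + |(n : ℝ)| * G * ((2 * Real.exp (1 / 2) - 1) * P.δ j / P.N j)) ^ 2 := by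
  obtain ⟨h, hhc, hh⟩ := exists_exactChirp lam'
  have hNr : (0 : ℝ) < P.N j := by exact_mod_cast hN
  have hπ : 0 < π := Real.pi_pos
  have hS' : ∀ q ∈ S, (P.N j : ℤ) ∣ q → (D' : ℤ) ≤ |q / P.N j + lam'| ∧ (D' : ℤ) ≤ |q / P.N j - lam'| := by
    intro q hq hdq
    refine sideband_div_of_mul hN hdq ?_
    rw [hlam]
    exact hS q hq hdq
  have hmain := integral_norm_sq_circleCutoff_twist_le (amp ⟨P.U j, P.U_periodic j, P.contDiff_U (P.δ_pos hδ₀ hd j)⟩ P.γ)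
    n lam' hN hh hhc (fun t => abs_phase_sub_nTooth_le P hδ₀ hd hN hG n lam' hlam t) hψc hψc1 hD' hS'
  have e : 2 * π * (|(n : ℝ)| * G * ((2 * Real.exp (1 / 2) - 1) * P.δ j / (2 * π * P.N j))) =
      |(n : ℝ)| * G * ((2 * Real.exp (1 / 2) - 1) * P.δ j / P.N j) := by
    field_simp
  rw [e] at hmain
  exact hmain

/-- **`E_n` of the phase-`j` chirp, even reduced strain** (`λ′ = nG/N_j` even — e.g. `G = 8`, `N_j = 2^j`, `j ≤ 2`): the bound of
`integral_norm_sq_circleCutoff_twist_cascade_le` with `4/π²` in place of `8/π²`.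
[cite: Grafakos2014, Prop. 3.1.2 (5) and Prop. 3.2.7 (3)] -/
theorem integral_norm_sq_circleCutoff_twist_cascade_le_of_even (P : CascadeParams) (hδ₀ : 0 < P.δ₀) (hd : 0 < P.d)
    {j : ℕ} (hN : 0 < P.N j) {G : ℕ} (hG : P.γ = G) (n lam' : ℤ) (hlam' : Even lam') (hlam : (P.N j : ℤ) * lam' = n * G)
    {ψc : ℤ → ℂ} {S : Finset ℤ} (hψc : ∀ m, m ∉ S → ψc m = 0) (hψc1 : ∀ m ∈ S, ‖ψc m‖ ≤ 1) {D' : ℕ} (hD' : 2 ≤ D')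
    (hS : ∀ q ∈ S, (P.N j : ℤ) ∣ q → (P.N j : ℤ) * D' ≤ |q + n * G| ∧ (P.N j : ℤ) * D' ≤ |q - n * G|) :
    ∫ y : UnitAddCircle, ‖∫ s : UnitAddCircle, (∑ l ∈ S, ψc l * fourier (-l) s) *
        twist (amp ⟨P.U j, P.U_periodic j, P.contDiff_U (P.δ_pos hδ₀ hd j)⟩ P.γ) n (y + s)‖ ^ 2 ≤
      (Real.sqrt (4 / π ^ 2 * (1 / ((D' : ℝ) - 1))) + |(n : ℝ)| * G * ((2 * Real.exp (1 / 2) - 1) * P.δ j / P.N j)) ^ 2 := by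
  obtain ⟨h, hhc, hh⟩ := exists_exactChirp lam'
  have hNr : (0 : ℝ) < P.N j := by exact_mod_cast hN
  have hπ : 0 < π := Real.pi_pos
  have hS' : ∀ q ∈ S, (P.N j : ℤ) ∣ q → (D' : ℤ) ≤ |q / P.N j + lam'| ∧ (D' : ℤ) ≤ |q / P.N j - lam'| := by
    intro q hq hdq
    refine sideband_div_of_mul hN hdq ?_
    rw [hlam]
    exact hS q hq hdq
  have hmain := integral_norm_sq_circleCutoff_twist_le_of_even
    (amp ⟨P.U j, P.U_periodic j, P.contDiff_U (P.δ_pos hδ₀ hd j)⟩ P.γ) n lam' hlam' hN hh hhc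
    (fun t => abs_phase_sub_nTooth_le P hδ₀ hd hN hG n lam' hlam t) hψc hψc1 hD' hS'
  have e : 2 * π * (|(n : ℝ)| * G * ((2 * Real.exp (1 / 2) - 1) * P.δ j / (2 * π * P.N j))) =
      |(n : ℝ)| * G * ((2 * Real.exp (1 / 2) - 1) * P.δ j / P.N j) := by
    field_simp
  rw [e] at hmain
  exact hmain

end Summit.AnomalousDissipation.AnomalousDissipation.Theorems.SawtoothPulseCascade.K1Start
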